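import Summits.NavierStokesRegularity.NavierStokesRegularity.Theorems.LerayQuarterDissipationFiniteDissipationLiouvilleThresholdOne
import Summits.NavierStokesRegularity.NavierStokesRegularity.Theorems.LerayQuarterDissipationFiniteDissipationLiouvilleTraceApexDss
import Summits.NavierStokesRegularity.NavierStokesRegularity.Theorems.LerayQuarterDissipationFiniteDissipationLiouvilleTraceSingularSet
import HarnessLib

/-!
# Crux `FiniteDissipationLiouville` (stmt-NavierStokesRegularity-22144): the DSS WALL below the gap —
# no backward discretely self-similar Type-I profile of ANY factor with Type-I constant `C ≤ 1 + ε(K)`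

Theorems file of route `LerayQuarterDissipation` (lead prover g14; `--supports` the crux; corollary of
`…ThresholdOne`). Navier–Stokes regularity is NOT proved by anything here; no summit is.

The route's DSS wall (`∀ c > 1, TypeIDSSLiouville c`, Bradshaw–Tsai OP 5.1) is NECESSARY for the crux
(`…Hardness`) and known only near `c = 1` (Chae–Wolf; the tree's uniform threshold `λ₀(C,K)`).
`…ThresholdOne` proves the crux for `C ≤ 1 + ε(K)`; on the stratum a past-DSS member that is regular
at the apex vanishes (`Birth.Apex.trace_locallyBounded_of_not_singularAt` +
`Birth.Apex.eq_zero_of_pastDss_of_trace_locallyBounded`, lead g4/g5). Hence: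

* `eq_zero_of_pastDss_of_typeI_le_one` — **a member of `𝒟_{C,K}` with `C ≤ 1` that is discretely
  self-similar on the past with ANY factor `c > 1` vanishes identically**;
* `exists_gap_eq_zero_of_pastDss` — **`∀ K ∃ ε > 0`: the same for every `C ≤ 1 + ε`** — the DSS wall
  holds on the finite-dissipation stratum below the gap, for all factors (large ones included),
  complementing the factor-near-one results.

HONEST FRAMING: `ε(K)` ineffective; nothing for larger `C`; the wall for all `C` stays OPEN.

References: Bradshaw–Tsai, Ann. Henri Poincaré 18 (2017) OP 5.1; Chae–Wolf, arXiv:1610.09464; KNSS 2009.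
-/

noncomputable section

set_option linter.dupNamespace false

namespace Summit.NavierStokesRegularity.NavierStokesRegularity.Theorems.FiniteDissipationLiouville.ThresholdOne

open MeasureTheory Set Filter Topology Metric Function
open Literature.Analysis Literature.Analysis.FluidPDE
open Summit.NavierStokesRegularity.NavierStokesRegularity.Theorems
open Summit.NavierStokesRegularity.NavierStokesRegularity.Theorems.FiniteDissipationLiouville

/-- On the stratum, a past-DSS member that is NOT singular at the apex vanishes on the past (the
trace is locally bounded at a regular point; a locally bounded homogeneous trace is zero). -/
theorem eq_zero_of_pastDss_of_not_singular {C K c : ℝ}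
    {W : ℝ → EuclideanSpace ℝ (Fin 3) → EuclideanSpace ℝ (Fin 3)} (hW : IsTypeIAncientMild C W)
    (hlaw : ∀ s : ℝ, s < 0 → ∫⁻ x, ‖fderiv ℝ (W s) x‖ₑ ^ 2 ≤ ENNReal.ofReal (K / Real.sqrt (-s)))
    (hc : 1 < c) (hdss : ∀ t : ℝ, t < 0 → ∀ x, c • W (c ^ 2 * t) (c • x) = W t x)
    (hreg : ¬ (∀ r > 0, ∀ M : ℝ, ∃ t ∈ Ioo (-(r ^ 2)) (0 : ℝ),
      ∃ x ∈ ball (0 : EuclideanSpace ℝ (Fin 3)) r, M < ‖W t x‖)) :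
    ∀ t < 0, ∀ x, W t x = 0 := by
  obtain ⟨r₀, M, hr₀, hbd⟩ := Birth.Apex.trace_locallyBounded_of_not_singularAt hW hlaw (a := 0) hreg
  refine Birth.Apex.eq_zero_of_pastDss_of_trace_locallyBounded hW hlaw hc hdss hr₀ (M := M)
    fun φ hφ hsupp L hL => hbd φ hφ (fun x hx => ?_) L hL
  rw [sub_zero]
  exact hsupp x hx

/-- **THE DSS WALL ON THE STRATUM AT THE THRESHOLD: a member of `𝒟_{C,K}` with `C ≤ 1` which is
discretely self-similar on the past with any factor `c > 1` vanishes identically** (`C ≤ 1` members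
are regular at the apex, `not_singular_of_typeI_le_one`; regular past-DSS members vanish). [cite: KochNadirashviliSereginSverak2009, §4 (arXiv:0709.3599 p. 8)] -/
theorem eq_zero_of_pastDss_of_typeI_le_one {C K c : ℝ} (hC : C ≤ 1)
    {W : ℝ → EuclideanSpace ℝ (Fin 3) → EuclideanSpace ℝ (Fin 3)} (hW : IsTypeIAncientMild C W)
    (hlaw : ∀ s : ℝ, s < 0 → ∫⁻ x, ‖fderiv ℝ (W s) x‖ₑ ^ 2 ≤ ENNReal.ofReal (K / Real.sqrt (-s)))
    (hc : 1 < c) (hdss : ∀ t : ℝ, t < 0 → ∀ x, c • W (c ^ 2 * t) (c • x) = W t x) :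
    ∀ t < 0, ∀ x, W t x = 0 :=
  eq_zero_of_pastDss_of_not_singular hW hlaw hc hdss (not_singular_of_typeI_le_one hC hW hlaw)

/-- **THE DSS WALL ON THE STRATUM BELOW THE GAP, EVERY FACTOR.** For every `K` there is `ε > 0` such
that every member of `𝒟_{C,K}` with `C ≤ 1 + ε` which is discretely self-similar on the past with some
factor `c > 1` vanishes identically (`exists_typeI_gap` + regular past-DSS members vanish). [cite: KochNadirashviliSereginSverak2009, §4 (arXiv:0709.3599 p. 8)] -/
theorem exists_gap_eq_zero_of_pastDss (K : ℝ) : ∃ ε : ℝ, 0 < ε ∧ ∀ C : ℝ, C ≤ 1 + ε →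
    ∀ (c : ℝ) (W : ℝ → EuclideanSpace ℝ (Fin 3) → EuclideanSpace ℝ (Fin 3)), 1 < c →
      IsTypeIAncientMild C W →
      (∀ s : ℝ, s < 0 → ∫⁻ x, ‖fderiv ℝ (W s) x‖ₑ ^ 2 ≤ ENNReal.ofReal (K / Real.sqrt (-s))) →
      (∀ t : ℝ, t < 0 → ∀ x, c • W (c ^ 2 * t) (c • x) = W t x) →
      ∀ t < 0, ∀ x, W t x = 0 := by
  obtain ⟨ε, hε, hgap⟩ := exists_typeI_gap K
  exact ⟨ε, hε, fun C hC c W hc hW hlaw hdss =>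
    eq_zero_of_pastDss_of_not_singular hW hlaw hc hdss (hgap C hC W hW hlaw)⟩

end Summit.NavierStokesRegularity.NavierStokesRegularity.Theorems.FiniteDissipationLiouville.ThresholdOne

end
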